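import Mathlib.FieldTheory.SeparableDegree
import Literature.NumberTheory.EllipticCurves.IsogenyFromRationalMap
import Literature.NumberTheory.EllipticCurves.IsogenyDegreeProofs
import Literature.NumberTheory.EllipticCurves.IsogenyDegreePullbackXProofs
import HarnessLib

/-!
# The degree of the isogeny attached to an explicit formula: `#ker = deg U`

Trunk T-ELLARITH; topic `NumberTheory/EllipticCurves`, notion `cm_endomorphisms_isogeny` (explicit
isogenies). A *proofs* file (theorems only) on top of
`Literature.NumberTheory.EllipticCurves.IsogenyFromRationalMap` (the isogeny
`IsogenyFormula.toIsogeny` attached to a rational map `(x, y) ↦ (U(x)/h(x)², (S(x)y + T(x))/h(x)³)`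
in standard form, Silverman, *AEC*, Thm. III.4.8) and the degree theory of the tree
(`IsogenyDegree`, `IsogenyDegreeProofs`, `IsogenyDegreeKernelProofs`,
`IsogenyDegreePullbackXProofs`). It proves:

* `WeierstrassCurve.IsogenyFormula.pullbackX_toIsogeny`: `φ^* x' = U(x)/h(x)²` in `K̄(E₁)`;
* `WeierstrassCurve.IsogenyFormula.deg_toIsogeny`: if `U` and `h` are coprime (over `K̄`), then
  Silverman's degree `deg φ = [K̄(E₁) : φ^* K̄(E₂)]` of the isogeny is `deg U`
  (`Isogeny.deg_eq_max_natDegree_of_pullbackX_eq`: `deg φ = max(deg U, deg h²)`, and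
  `deg h² < deg U` is part of the formula);
* `WeierstrassCurve.IsogenyFormula.degree_toIsogeny`: in characteristic `0` the prelude's
  `Isogeny.degree = #ker φ` (the separable degree, *AEC* Thm. III.4.10(a),
  `Isogeny.card_ker_eq_finSepDegree_holds`) equals `deg U` as well, every finite extension being
  separable (`Isogeny.finiteDimensional_pullbackField_holds`, *AEC* Thm. II.2.4(a)).

This is the standard reading of the degree of a cyclic isogeny off its `x`-coordinate map
(Silverman, *AEC*, III.4, Remark 4.13.3 and Exercise 3.7(d): `deg [m] = m²` from
`x ∘ [m] = Φₘ/Ψₘ²`); it is what turns a kernel-checked isogeny certificate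
(`Literature.NumberTheory.EllipticCurves.IsogenyFormulaCert`) of prime degree `ℓ` into an isogeny
of non-square degree, as needed for complex multiplication (`Isogeny.hasCM_of_j_eq`,
`ComplexMultiplicationHasCMProofs`).

## References

* [SilvermanAEC2009] J. H. Silverman, *The Arithmetic of Elliptic Curves*, 2nd ed., GTM 106,
  Springer 2009: Thm. II.2.4(a); III.§4 (p. 66, `deg φ`), Thm. III.4.8, Thm. III.4.10(a),(c),
  Remark III.4.13.3, Exercise 3.7(d).

## Design

`noncomputable section`, `open scoped Classical`, one universe `u`; dot-notation extensions in
`namespace WeierstrassCurve.IsogenyFormula`. Mathlib has no isogenies; the tree's `Isogeny`,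
`IsogenyFormula`, `Isogeny.deg`, `RationalRep` are used and nothing is restated (`lean search`
for `degree_toIsogeny`, `deg_toIsogeny`, `pullbackX_toIsogeny` found only
`IsVeluThreePair.degree_toIsogeny` of `ThreeIsogeny`, the degree-`3` special case by point count).
-/

noncomputable section

open scoped Classical

open Polynomial

universe u

namespace WeierstrassCurve

namespace IsogenyFormula

variable {K : Type u} [Field K] {W₁ W₂ : WeierstrassCurve K} [W₁.IsElliptic] [W₂.IsElliptic]
  [CharZero K] (φ : IsogenyFormula W₁ W₂)

omit [W₁.IsElliptic] [CharZero K] in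
/-- Evaluating `p(X₀)` at the generic point `(x, y)` of `E` gives `p(x) ∈ K̄(E)`. [folklore] -/
theorem evalGeneric_aeval_X_zero (p : (AlgebraicClosure K)[X]) :
    W₁.evalGeneric (Polynomial.aeval (MvPolynomial.X 0 : MvPolynomial (Fin 2) (AlgebraicClosure K)) p) =
      Polynomial.aeval W₁.genX p := by
  rw [evalGeneric_eq_aeval, ← Polynomial.aeval_algHom_apply, MvPolynomial.aeval_X,
    Matrix.cons_val_zero]

/-- **`φ^* x' = U(x)/h(x)²` in `K̄(E₁)`** for the isogeny of an explicit formula (the pull-back of the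
first Weierstrass coordinate does not depend on the rational representation,
`Isogeny.pullbackX_eq`). Silverman, *AEC*, II.§2 (`φ^* f = f ∘ φ`), Remark III.4.13.3.
[cite: SilvermanAEC2009, Remark III.4.13.3 (PDF p. 73)] -/
theorem pullbackX_toIsogeny :
    φ.toIsogeny.pullbackX =
      Polynomial.aeval W₁.genX (φ.U.map (algebraMap K (AlgebraicClosure K))) /
        Polynomial.aeval W₁.genX ((φ.h.map (algebraMap K (AlgebraicClosure K))) ^ 2) := by
  -- the formula is a rational representation of its isogeny (as in `isAlgebraicOn_geomHom`)
  let r : RationalRep W₁ W₂ φ.toIsogeny :=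
    { P₁ := Polynomial.aeval (MvPolynomial.X 0) φ.geom.U
      Q₁ := Polynomial.aeval (MvPolynomial.X 0) (φ.geom.h ^ 2)
      P₂ := Polynomial.aeval (MvPolynomial.X 0) φ.geom.S * MvPolynomial.X 1 +
        Polynomial.aeval (MvPolynomial.X 0) φ.geom.T
      Q₂ := Polynomial.aeval (MvPolynomial.X 0) (φ.geom.h ^ 3)
      finite := by
        refine φ.geom.finite_bad.subset ?_
        intro P hP
        by_contra hPb
        apply hP
        obtain ⟨x, y, hxy, rfl, hx⟩ := φ.geom.exists_of_not_mem_bad hPb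
        refine ⟨x, y, hxy, rfl, ?_, ?_, ?_⟩
        · rw [eval_aeval_X_zero]; simpa using pow_ne_zero 2 hx
        · rw [eval_aeval_X_zero]; simpa using pow_ne_zero 3 hx
        · have h1 : MvPolynomial.eval ![x, y] (Polynomial.aeval (MvPolynomial.X 0) φ.geom.U) /
              MvPolynomial.eval ![x, y] (Polynomial.aeval (MvPolynomial.X 0) (φ.geom.h ^ 2)) =
              φ.geom.valX x := by
            rw [eval_aeval_X_zero, eval_aeval_X_zero, eval_pow]; rfl
          have h2 : MvPolynomial.eval ![x, y] (Polynomial.aeval (MvPolynomial.X 0) φ.geom.S *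
              MvPolynomial.X 1 + Polynomial.aeval (MvPolynomial.X 0) φ.geom.T) /
              MvPolynomial.eval ![x, y] (Polynomial.aeval (MvPolynomial.X 0) (φ.geom.h ^ 3)) =
              φ.geom.valY x y := by
            rw [map_add, map_mul, eval_aeval_X_zero, eval_aeval_X_zero, eval_aeval_X_zero,
              MvPolynomial.eval_X, eval_pow]; rfl
          refine ⟨by rw [h1, h2]; exact φ.geom.nonsingular_val hxy.1 hx, ?_⟩
          change φ.toIsogeny.toAddMonoidHom (Affine.Point.some x y hxy) = _
          rw [show φ.toIsogeny.toAddMonoidHom = φ.geomHom from rfl, φ.geomHom_some hxy hx]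
          congr 1 <;> simp only [h1, h2] }
  rw [φ.toIsogeny.pullbackX_eq r, RationalRep.pullbackX]
  change W₁.evalGeneric (Polynomial.aeval (MvPolynomial.X 0) φ.geom.U) /
      W₁.evalGeneric (Polynomial.aeval (MvPolynomial.X 0) (φ.geom.h ^ 2)) = _
  rw [evalGeneric_aeval_X_zero, evalGeneric_aeval_X_zero]
  rfl

/-- **`deg φ = deg U`** for the isogeny of an explicit formula `(U/h², (S y + T)/h³)` with `U`, `h`
coprime: by `Isogeny.deg_eq_max_natDegree_of_pullbackX_eq`, `deg φ = max(deg U, deg h²)`, and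
`deg h² < deg U` (`IsogenyFormula.natDegree_lt`). Silverman, *AEC*, III.§4 (Remark 4.13.3: for a
separable isogeny with kernel polynomial `h` of degree `(ℓ - 1)/2`… here only the coprimality of
numerator and denominator of the `x`-map is used), Exercise 3.7(d).
[cite: SilvermanAEC2009, Remark III.4.13.3 and Exercise 3.7(d)] -/
theorem deg_toIsogeny
    (hcop : IsCoprime (φ.U.map (algebraMap K (AlgebraicClosure K)))
      (φ.h.map (algebraMap K (AlgebraicClosure K)))) :
    φ.toIsogeny.deg = φ.U.natDegree := by
  have hinj := (algebraMap K (AlgebraicClosure K)).injective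
  rw [φ.toIsogeny.deg_eq_max_natDegree_of_pullbackX_eq hcop.pow_right φ.pullbackX_toIsogeny,
    ← Polynomial.map_pow, natDegree_map_eq_of_injective hinj, natDegree_map_eq_of_injective hinj]
  exact max_eq_left φ.natDegree_lt.le

/-- **`#ker φ = deg U`** in characteristic `0` for the isogeny of an explicit formula with `U`, `h`
coprime: the prelude's `Isogeny.degree = #ker φ` is the separable degree
`[K̄(E₁) : φ^* K̄(E₂)]_s` (Silverman, *AEC*, Thm. III.4.10(a); the tree's
`Isogeny.card_ker_eq_finSepDegree_holds`), which is the full degree `deg φ` because the finite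
extension `K̄(E₁)/φ^* K̄(E₂)` (*AEC* Thm. II.2.4(a), `Isogeny.finiteDimensional_pullbackField_holds`)
is separable in characteristic `0` (*AEC* Thm. III.4.10(c)); and `deg φ = deg U` (`deg_toIsogeny`).
[cite: SilvermanAEC2009, Thm. III.4.10(a),(c)] -/
theorem degree_toIsogeny
    (hcop : IsCoprime (φ.U.map (algebraMap K (AlgebraicClosure K)))
      (φ.h.map (algebraMap K (AlgebraicClosure K)))) :
    φ.toIsogeny.degree = φ.U.natDegree := by
  set L := W₁.geomFunctionField
  haveI hfin : FiniteDimensional φ.toIsogeny.pullbackField L :=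
    Isogeny.finiteDimensional_pullbackField_holds W₁ W₂ φ.toIsogeny
  haveI : CharZero L := charZero_of_injective_ringHom (algebraMap K L).injective
  haveI : CharZero φ.toIsogeny.pullbackField := (algebraMap φ.toIsogeny.pullbackField L).charZero
  haveI : Algebra.IsSeparable φ.toIsogeny.pullbackField L :=
    Algebra.IsAlgebraic.isSeparable_of_perfectField
  rw [Isogeny.degree, Isogeny.card_ker_eq_finSepDegree_holds W₁ W₂ φ.toIsogeny,
    Field.finSepDegree_eq_finrank_of_isSeparable, ← φ.deg_toIsogeny hcop]
  rfl

end IsogenyFormula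

end WeierstrassCurve

end
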